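import Summits.CriticalPhenomena.PercolationContinuityZ3.Theorems.PercNearOneGluingNoHeavyLowerTailCubicThreePointJoinDense
import Summits.CriticalPhenomena.PercolationContinuityZ3.Theorems.PercNearOneGluingNoHeavyLowerTailCubicThreePointSharpDichotomy
import Mathlib.Tactic.Ring
import Mathlib.Tactic.Linarith
import Mathlib.Tactic.Positivity
import HarnessLib

/-!
# `NoHeavyLowerTail` (stmt-CriticalPhenomena-4575) — the K3-SEMIGROUP THEOREM for the sharp cubic form:
# `{AG ≥ 0, Hmax3 ≥ 0}` is closed under parallel composition of three-terminal laws

Support file (prover prim-gen-kcluster gen 9, k-cluster line; `--supports stmt-CriticalPhenomena-4575`).  Pure real algebra on top of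
`…CubicThreePointTerminalClosure` (`AG`, `Ha = t·AG − e₃`, `Hb = q·AG − e₃`) and `…CubicThreePointJoinDense` (dense × dense case);
no definitions, no named facts, no sorries.  Cells `(q,u₁,u₂,u₃,t) = (P(a|b|c), P(ab|c), P(ac|b), P(bc|a), P(abc))`.

PARALLEL COMPOSITION (join in the partition lattice of the three terminals; bilinear in the two laws `x = (q,u,t)`, `y = (Q,v,T)`):
  `z_q = qQ`,  `z_i = q vᵢ + uᵢ Q + uᵢ vᵢ`,  `z_t = t·σ(y) + T·σ(x) − tT + Σ_{i≠j} uᵢ vⱼ`.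
For REALIZABLE `x, y` (laws of 3-sunflower systems) `z` is the law of the two systems run independently and glued at the terminals,
so e.g. `AG(z) ≥ 0` is again Gladkov's theorem; the point of this file is that the SEMIALGEBRAIC set
  `S₀ = {cells ≥ 0, AG ≥ 0, max(Ha, Hb) ≥ 0}`   (`max(Ha,Hb) = max(q,t)·AG − e₃ = Hmax3` for `AG ≥ 0`)
is closed under `⊔` by explicit identities — so the conjectured sharp row `Hmax3 ≥ 0` propagates through parallel (and, dually, meet)
composition without any appeal to realizability:
* `AG_join`:  `AG(z) = (Q² + QΣv)·AG(x) + q·σ(x)·AG(y) + Σ_{i<j} vᵢvⱼ·(AG(x) + u_k(q+uᵢ+uⱼ)) + Q·Σᵢ vᵢ uⱼu_k`  (`≥ 0`);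
* `Hb_join`:  `Hb(z) = Q²σ(y)·Hb(x) + (q+u₁)(q+u₂)(q+u₃)·Hb(y)`  (so the sparse patch `{Hb ≥ 0}` is a sub-semigroup);
* `Ha_join_dense_sparse`: `x` dense-type (`AG, Ha ≥ 0`, `t ≥ q`) and `y` with `AG ≥ 0`, `Hb ≥ 0` ⇒ `Ha(z) ≥ 0`, by an exact integer
  certificate `12·Ha(z) = Σ c_k m_k(x) m'_k(y)` (341 terms; generators: cells, `AG`, `Ha(x)`, `t−q`, `Hb(y)`; LP-found over
  `S₃`-symmetrised products, run/shared/lean/prim/prim-gen-kcluster/code/gen9/num/jcert_gen.py, cert_M.json; verified by `ring`);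
* with `Ha_join_dense_dense` (`…JoinDense`):  **`maxH_join_nonneg`** — `x, y ∈ S₀ ⇒ z ∈ S₀`.
CONSEQUENCE.  Every 3-sunflower law in the join/meet algebra generated by `S₀` (two-point laws, stars = meets of pendant laws,
triangles = joins of chords, `K₄ = star ⊔ triangle`, `K_{2,3} = star ⊔ star`, all series–parallel nestings, E/T-constructible graphs …)
satisfies `Hmax3 ≥ 0`, hence `H_{q+t} ≥ 0`, AG⁺ and SHK3⁺ — the meet case being the `q ↔ t` dual (`Ha ↔ Hb`, `AG`, `S₀` self-dual).
General graphs are not in this algebra; for them `Hmax3 ≥ 0` remains the conjecture "every 3-point law is a diluted star or a clamped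
triangle" (`…CubicThreePointSharpDichotomy`).
[cite: Gladkov2024StrongFKG, Cor. 4.2 (the quadratic form AG)]; [cite: GladkovZimin2024HK, §4 (one-coordinate decomposition)]
-/

namespace Summit.CriticalPhenomena.PercolationContinuityZ3.Theorems

namespace CubicThreePointJoin

open CubicThreePointTerminal CubicThreePointSharp

variable {R : Type*} [CommRing R]

/-- `AG` under parallel composition (identity in any commutative ring; every summand is a product of cells and `AG`'s). [folklore] -/
theorem AG_join (q u₁ u₂ u₃ t Q v₁ v₂ v₃ T : R) :
    AG (q * Q) (q * v₁ + u₁ * Q + u₁ * v₁) (q * v₂ + u₂ * Q + u₂ * v₂) (q * v₃ + u₃ * Q + u₃ * v₃)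
        (t * (Q + v₁ + v₂ + v₃ + T) + T * (q + u₁ + u₂ + u₃) + (u₁ * (v₂ + v₃) + u₂ * (v₁ + v₃) + u₃ * (v₁ + v₂))) =
      (Q * Q + Q * (v₁ + v₂ + v₃)) * AG q u₁ u₂ u₃ t + q * (q + u₁ + u₂ + u₃ + t) * AG Q v₁ v₂ v₃ T
        + (v₁ * v₂ * (AG q u₁ u₂ u₃ t + u₃ * (q + u₁ + u₂)) + v₁ * v₃ * (AG q u₁ u₂ u₃ t + u₂ * (q + u₁ + u₃))
          + v₂ * v₃ * (AG q u₁ u₂ u₃ t + u₁ * (q + u₂ + u₃)))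
        + Q * (v₁ * (u₂ * u₃) + v₂ * (u₁ * u₃) + v₃ * (u₁ * u₂)) := by
  simp only [AG]; ring

/-- `Hb` under parallel composition: `Hb(z) = Q²σ(y)·Hb(x) + (q+u₁)(q+u₂)(q+u₃)·Hb(y)` — the sparse patch `{Hb ≥ 0}` is closed. [folklore] -/
theorem Hb_join (q u₁ u₂ u₃ t Q v₁ v₂ v₃ T : R) :
    Hb (q * Q) (q * v₁ + u₁ * Q + u₁ * v₁) (q * v₂ + u₂ * Q + u₂ * v₂) (q * v₃ + u₃ * Q + u₃ * v₃)
        (t * (Q + v₁ + v₂ + v₃ + T) + T * (q + u₁ + u₂ + u₃) + (u₁ * (v₂ + v₃) + u₂ * (v₁ + v₃) + u₃ * (v₁ + v₂))) =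
      Q * Q * (Q + v₁ + v₂ + v₃ + T) * Hb q u₁ u₂ u₃ t + (q + u₁) * (q + u₂) * (q + u₃) * Hb Q v₁ v₂ v₃ T := by
  simp only [Hb]; ring

/-- `AG ≥ 0` is preserved by parallel composition (from `AG_join`). [folklore] -/
theorem AG_join_nonneg {q u₁ u₂ u₃ t Q v₁ v₂ v₃ T zq z₁ z₂ z₃ zt : ℝ}
    (hq : 0 ≤ q) (hu₁ : 0 ≤ u₁) (hu₂ : 0 ≤ u₂) (hu₃ : 0 ≤ u₃) (ht : 0 ≤ t)
    (hQ : 0 ≤ Q) (hv₁ : 0 ≤ v₁) (hv₂ : 0 ≤ v₂) (hv₃ : 0 ≤ v₃)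
    (hagx : 0 ≤ AG q u₁ u₂ u₃ t) (hagy : 0 ≤ AG Q v₁ v₂ v₃ T)
    (hzq : zq = q * Q) (hz₁ : z₁ = q * v₁ + u₁ * Q + u₁ * v₁) (hz₂ : z₂ = q * v₂ + u₂ * Q + u₂ * v₂)
    (hz₃ : z₃ = q * v₃ + u₃ * Q + u₃ * v₃)
    (hzt : zt = t * (Q + v₁ + v₂ + v₃ + T) + T * (q + u₁ + u₂ + u₃) + (u₁ * (v₂ + v₃) + u₂ * (v₁ + v₃) + u₃ * (v₁ + v₂))) :
    0 ≤ AG zq z₁ z₂ z₃ zt := by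
  subst hzq hz₁ hz₂ hz₃ hzt
  rw [AG_join]
  generalize AG q u₁ u₂ u₃ t = A at hagx ⊢
  generalize AG Q v₁ v₂ v₃ T = A' at hagy ⊢
  positivity

/-- `Hb ≥ 0` for both factors ⇒ `Hb ≥ 0` for the parallel composition (from `Hb_join`). [folklore] -/
theorem Hb_join_nonneg {q u₁ u₂ u₃ t Q v₁ v₂ v₃ T zq z₁ z₂ z₃ zt : ℝ}
    (hq : 0 ≤ q) (hu₁ : 0 ≤ u₁) (hu₂ : 0 ≤ u₂) (hu₃ : 0 ≤ u₃)
    (hQ : 0 ≤ Q) (hv₁ : 0 ≤ v₁) (hv₂ : 0 ≤ v₂) (hv₃ : 0 ≤ v₃) (hT : 0 ≤ T)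
    (hbx : 0 ≤ Hb q u₁ u₂ u₃ t) (hby : 0 ≤ Hb Q v₁ v₂ v₃ T)
    (hzq : zq = q * Q) (hz₁ : z₁ = q * v₁ + u₁ * Q + u₁ * v₁) (hz₂ : z₂ = q * v₂ + u₂ * Q + u₂ * v₂)
    (hz₃ : z₃ = q * v₃ + u₃ * Q + u₃ * v₃)
    (hzt : zt = t * (Q + v₁ + v₂ + v₃ + T) + T * (q + u₁ + u₂ + u₃) + (u₁ * (v₂ + v₃) + u₂ * (v₁ + v₃) + u₃ * (v₁ + v₂))) :
    0 ≤ Hb zq z₁ z₂ z₃ zt := by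
  subst hzq hz₁ hz₂ hz₃ hzt
  rw [Hb_join]
  generalize Hb q u₁ u₂ u₃ t = B at hbx ⊢
  generalize Hb Q v₁ v₂ v₃ T = B' at hby ⊢
  positivity

set_option maxHeartbeats 4000000 in
/-- **Dense × sparse.**  `x` dense-type (cells `≥ 0`, `AG ≥ 0`, `Ha ≥ 0`, `t ≥ q`) and `y` with cells `≥ 0`, `AG ≥ 0`, `Hb ≥ 0`
⇒ the parallel composition has `Ha ≥ 0`: `12·Ha(z)` is an explicit nonnegative integer combination of generator products. [folklore] -/
theorem Ha_join_dense_sparse {q u₁ u₂ u₃ t Q v₁ v₂ v₃ T zq z₁ z₂ z₃ zt : ℝ}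
    (hq : 0 ≤ q) (hu₁ : 0 ≤ u₁) (hu₂ : 0 ≤ u₂) (hu₃ : 0 ≤ u₃) (ht : 0 ≤ t)
    (hQ : 0 ≤ Q) (hv₁ : 0 ≤ v₁) (hv₂ : 0 ≤ v₂) (hv₃ : 0 ≤ v₃) (hT : 0 ≤ T)
    (hagx : 0 ≤ AG q u₁ u₂ u₃ t) (hagy : 0 ≤ AG Q v₁ v₂ v₃ T) (hHax : 0 ≤ Ha q u₁ u₂ u₃ t) (htqx : 0 ≤ t - q)
    (hHby : 0 ≤ Hb Q v₁ v₂ v₃ T)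
    (hzq : zq = q * Q) (hz₁ : z₁ = q * v₁ + u₁ * Q + u₁ * v₁) (hz₂ : z₂ = q * v₂ + u₂ * Q + u₂ * v₂)
    (hz₃ : z₃ = q * v₃ + u₃ * Q + u₃ * v₃)
    (hzt : zt = t * (Q + v₁ + v₂ + v₃ + T) + T * (q + u₁ + u₂ + u₃) + (u₁ * (v₂ + v₃) + u₂ * (v₁ + v₃) + u₃ * (v₁ + v₂))) :
    0 ≤ Ha zq z₁ z₂ z₃ zt := by
  have key : 12 * Ha zq z₁ z₂ z₃ zt =
      q * q * q * (12 * ((AG Q v₁ v₂ v₃ T) * T)) + q * q * u₁ * (6 * (v₂ * v₃ * T) + 6 * (v₃ * v₂ * T)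
        + 12 * ((AG Q v₁ v₂ v₃ T) * v₂) + 12 * ((AG Q v₁ v₂ v₃ T) * v₃) + 24 * ((AG Q v₁ v₂ v₃ T) * T))
        + q * q * u₂ * (6 * (v₁ * v₃ * T) + 6 * (v₃ * v₁ * T) + 12 * ((AG Q v₁ v₂ v₃ T) * v₁)
        + 12 * ((AG Q v₁ v₂ v₃ T) * v₃) + 24 * ((AG Q v₁ v₂ v₃ T) * T)) + q * q * u₃ * (6 * (v₁ * v₂ * T)
        + 6 * (v₂ * v₁ * T) + 12 * ((AG Q v₁ v₂ v₃ T) * v₁) + 12 * ((AG Q v₁ v₂ v₃ T) * v₂)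
        + 24 * ((AG Q v₁ v₂ v₃ T) * T)) + q * q * t * (12 * ((AG Q v₁ v₂ v₃ T) * v₁) + 12 * ((AG Q v₁ v₂ v₃ T) * v₂)
        + 12 * ((AG Q v₁ v₂ v₃ T) * v₃) + 12 * ((AG Q v₁ v₂ v₃ T) * T) + 12 * ((Hb Q v₁ v₂ v₃ T)))
        + q * u₁ * u₁ * (12 * (v₂ * v₂ * v₃) + 12 * (v₃ * v₃ * v₂) + 6 * (v₂ * v₃ * T) + 6 * (v₃ * v₂ * T)
        + 12 * ((AG Q v₁ v₂ v₃ T) * v₂) + 12 * ((AG Q v₁ v₂ v₃ T) * v₃) + 12 * ((AG Q v₁ v₂ v₃ T) * T))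
        + q * u₂ * u₂ * (12 * (v₁ * v₁ * v₃) + 12 * (v₃ * v₃ * v₁) + 6 * (v₁ * v₃ * T) + 6 * (v₃ * v₁ * T)
        + 12 * ((AG Q v₁ v₂ v₃ T) * v₁) + 12 * ((AG Q v₁ v₂ v₃ T) * v₃) + 12 * ((AG Q v₁ v₂ v₃ T) * T))
        + q * u₃ * u₃ * (12 * (v₁ * v₁ * v₂) + 12 * (v₂ * v₂ * v₁) + 6 * (v₁ * v₂ * T) + 6 * (v₂ * v₁ * T)
        + 12 * ((AG Q v₁ v₂ v₃ T) * v₁) + 12 * ((AG Q v₁ v₂ v₃ T) * v₂) + 12 * ((AG Q v₁ v₂ v₃ T) * T))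
        + q * u₁ * u₂ * (12 * (Q * v₃ * T) + 24 * (v₁ * v₃ * T) + 12 * ((AG Q v₁ v₂ v₃ T) * v₁)
        + 6 * ((AG Q v₁ v₂ v₃ T) * v₃) + 18 * ((AG Q v₁ v₂ v₃ T) * T)) + q * u₁ * u₃ * (12 * (Q * v₂ * T)
        + 24 * (v₁ * v₂ * T) + 12 * ((AG Q v₁ v₂ v₃ T) * v₁) + 6 * ((AG Q v₁ v₂ v₃ T) * v₂)
        + 18 * ((AG Q v₁ v₂ v₃ T) * T)) + q * u₂ * u₁ * (12 * (Q * v₃ * T) + 24 * (v₂ * v₃ * T)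
        + 12 * ((AG Q v₁ v₂ v₃ T) * v₂) + 6 * ((AG Q v₁ v₂ v₃ T) * v₃) + 18 * ((AG Q v₁ v₂ v₃ T) * T))
        + q * u₂ * u₃ * (12 * (Q * v₁ * T) + 24 * (v₂ * v₁ * T) + 12 * ((AG Q v₁ v₂ v₃ T) * v₂)
        + 6 * ((AG Q v₁ v₂ v₃ T) * v₁) + 18 * ((AG Q v₁ v₂ v₃ T) * T)) + q * u₃ * u₁ * (12 * (Q * v₂ * T)
        + 24 * (v₃ * v₂ * T) + 12 * ((AG Q v₁ v₂ v₃ T) * v₃) + 6 * ((AG Q v₁ v₂ v₃ T) * v₂)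
        + 18 * ((AG Q v₁ v₂ v₃ T) * T)) + q * u₃ * u₂ * (12 * (Q * v₁ * T) + 24 * (v₃ * v₁ * T)
        + 12 * ((AG Q v₁ v₂ v₃ T) * v₃) + 6 * ((AG Q v₁ v₂ v₃ T) * v₁) + 18 * ((AG Q v₁ v₂ v₃ T) * T))
        + q * u₁ * t * (6 * (Q * v₂ * v₃) + 6 * (Q * v₃ * v₂) + 8 * (v₁ * v₂ * v₃) + 8 * (v₁ * v₃ * v₂)
        + 20 * (v₂ * v₂ * v₃) + 20 * (v₃ * v₃ * v₂) + 9 * (v₂ * v₃ * T) + 9 * (v₃ * v₂ * T)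
        + 12 * ((AG Q v₁ v₂ v₃ T) * v₁) + 20 * ((AG Q v₁ v₂ v₃ T) * v₂) + 20 * ((AG Q v₁ v₂ v₃ T) * v₃)
        + 18 * ((AG Q v₁ v₂ v₃ T) * T)) + q * u₂ * t * (6 * (Q * v₁ * v₃) + 6 * (Q * v₃ * v₁) + 8 * (v₂ * v₁ * v₃)
        + 8 * (v₂ * v₃ * v₁) + 20 * (v₁ * v₁ * v₃) + 20 * (v₃ * v₃ * v₁) + 9 * (v₁ * v₃ * T) + 9 * (v₃ * v₁ * T)
        + 12 * ((AG Q v₁ v₂ v₃ T) * v₂) + 20 * ((AG Q v₁ v₂ v₃ T) * v₁) + 20 * ((AG Q v₁ v₂ v₃ T) * v₃)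
        + 18 * ((AG Q v₁ v₂ v₃ T) * T)) + q * u₃ * t * (6 * (Q * v₁ * v₂) + 6 * (Q * v₂ * v₁) + 8 * (v₃ * v₁ * v₂)
        + 8 * (v₃ * v₂ * v₁) + 20 * (v₁ * v₁ * v₂) + 20 * (v₂ * v₂ * v₁) + 9 * (v₁ * v₂ * T) + 9 * (v₂ * v₁ * T)
        + 12 * ((AG Q v₁ v₂ v₃ T) * v₃) + 20 * ((AG Q v₁ v₂ v₃ T) * v₁) + 20 * ((AG Q v₁ v₂ v₃ T) * v₂)
        + 18 * ((AG Q v₁ v₂ v₃ T) * T)) + u₁ * u₁ * u₂ * (12 * (Q * v₃ * v₃) + 16 * (Q * v₃ * T)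
        + 8 * (v₁ * v₃ * v₃) + 12 * (v₁ * v₃ * T) + 4 * (v₂ * v₂ * v₃) + 6 * (v₂ * v₃ * T)
        + 4 * ((AG Q v₁ v₂ v₃ T) * Q) + 4 * ((AG Q v₁ v₂ v₃ T) * v₂) + 6 * ((AG Q v₁ v₂ v₃ T) * T)
        + 8 * ((Hb Q v₁ v₂ v₃ T))) + u₁ * u₁ * u₃ * (12 * (Q * v₂ * v₂) + 16 * (Q * v₂ * T) + 8 * (v₁ * v₂ * v₂)
        + 12 * (v₁ * v₂ * T) + 4 * (v₃ * v₃ * v₂) + 6 * (v₃ * v₂ * T) + 4 * ((AG Q v₁ v₂ v₃ T) * Q)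
        + 4 * ((AG Q v₁ v₂ v₃ T) * v₃) + 6 * ((AG Q v₁ v₂ v₃ T) * T) + 8 * ((Hb Q v₁ v₂ v₃ T)))
        + u₂ * u₂ * u₁ * (12 * (Q * v₃ * v₃) + 16 * (Q * v₃ * T) + 8 * (v₂ * v₃ * v₃) + 12 * (v₂ * v₃ * T)
        + 4 * (v₁ * v₁ * v₃) + 6 * (v₁ * v₃ * T) + 4 * ((AG Q v₁ v₂ v₃ T) * Q) + 4 * ((AG Q v₁ v₂ v₃ T) * v₁)
        + 6 * ((AG Q v₁ v₂ v₃ T) * T) + 8 * ((Hb Q v₁ v₂ v₃ T))) + u₂ * u₂ * u₃ * (12 * (Q * v₁ * v₁)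
        + 16 * (Q * v₁ * T) + 8 * (v₂ * v₁ * v₁) + 12 * (v₂ * v₁ * T) + 4 * (v₃ * v₃ * v₁) + 6 * (v₃ * v₁ * T)
        + 4 * ((AG Q v₁ v₂ v₃ T) * Q) + 4 * ((AG Q v₁ v₂ v₃ T) * v₃) + 6 * ((AG Q v₁ v₂ v₃ T) * T)
        + 8 * ((Hb Q v₁ v₂ v₃ T))) + u₃ * u₃ * u₁ * (12 * (Q * v₂ * v₂) + 16 * (Q * v₂ * T) + 8 * (v₃ * v₂ * v₂)
        + 12 * (v₃ * v₂ * T) + 4 * (v₁ * v₁ * v₂) + 6 * (v₁ * v₂ * T) + 4 * ((AG Q v₁ v₂ v₃ T) * Q)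
        + 4 * ((AG Q v₁ v₂ v₃ T) * v₁) + 6 * ((AG Q v₁ v₂ v₃ T) * T) + 8 * ((Hb Q v₁ v₂ v₃ T)))
        + u₃ * u₃ * u₂ * (12 * (Q * v₁ * v₁) + 16 * (Q * v₁ * T) + 8 * (v₃ * v₁ * v₁) + 12 * (v₃ * v₁ * T)
        + 4 * (v₂ * v₂ * v₁) + 6 * (v₂ * v₁ * T) + 4 * ((AG Q v₁ v₂ v₃ T) * Q) + 4 * ((AG Q v₁ v₂ v₃ T) * v₂)
        + 6 * ((AG Q v₁ v₂ v₃ T) * T) + 8 * ((Hb Q v₁ v₂ v₃ T))) + u₁ * u₂ * u₃ * (8 * (Q * v₁ * T)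
        + 3 * (Q * T * T) + 6 * ((AG Q v₁ v₂ v₃ T) * Q) + 2 * ((AG Q v₁ v₂ v₃ T) * v₁))
        + u₁ * u₃ * u₂ * (8 * (Q * v₁ * T) + 3 * (Q * T * T) + 6 * ((AG Q v₁ v₂ v₃ T) * Q)
        + 2 * ((AG Q v₁ v₂ v₃ T) * v₁)) + u₂ * u₁ * u₃ * (8 * (Q * v₂ * T) + 3 * (Q * T * T)
        + 6 * ((AG Q v₁ v₂ v₃ T) * Q) + 2 * ((AG Q v₁ v₂ v₃ T) * v₂)) + u₂ * u₃ * u₁ * (8 * (Q * v₂ * T)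
        + 3 * (Q * T * T) + 6 * ((AG Q v₁ v₂ v₃ T) * Q) + 2 * ((AG Q v₁ v₂ v₃ T) * v₂))
        + u₃ * u₁ * u₂ * (8 * (Q * v₃ * T) + 3 * (Q * T * T) + 6 * ((AG Q v₁ v₂ v₃ T) * Q)
        + 2 * ((AG Q v₁ v₂ v₃ T) * v₃)) + u₃ * u₂ * u₁ * (8 * (Q * v₃ * T) + 3 * (Q * T * T)
        + 6 * ((AG Q v₁ v₂ v₃ T) * Q) + 2 * ((AG Q v₁ v₂ v₃ T) * v₃)) + u₁ * u₂ * t * (12 * (Q * v₁ * v₃)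
        + 6 * (Q * v₃ * v₃) + 12 * (Q * v₃ * T) + 12 * (v₁ * v₁ * v₃) + 6 * (v₁ * v₂ * v₃) + 12 * (v₁ * v₃ * T)
        + 6 * ((AG Q v₁ v₂ v₃ T) * Q) + 12 * ((AG Q v₁ v₂ v₃ T) * v₁) + 6 * ((AG Q v₁ v₂ v₃ T) * T))
        + u₁ * u₃ * t * (12 * (Q * v₁ * v₂) + 6 * (Q * v₂ * v₂) + 12 * (Q * v₂ * T) + 12 * (v₁ * v₁ * v₂)
        + 6 * (v₁ * v₃ * v₂) + 12 * (v₁ * v₂ * T) + 6 * ((AG Q v₁ v₂ v₃ T) * Q) + 12 * ((AG Q v₁ v₂ v₃ T) * v₁)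
        + 6 * ((AG Q v₁ v₂ v₃ T) * T)) + u₂ * u₁ * t * (12 * (Q * v₂ * v₃) + 6 * (Q * v₃ * v₃) + 12 * (Q * v₃ * T)
        + 12 * (v₂ * v₂ * v₃) + 6 * (v₂ * v₁ * v₃) + 12 * (v₂ * v₃ * T) + 6 * ((AG Q v₁ v₂ v₃ T) * Q)
        + 12 * ((AG Q v₁ v₂ v₃ T) * v₂) + 6 * ((AG Q v₁ v₂ v₃ T) * T)) + u₂ * u₃ * t * (12 * (Q * v₂ * v₁)
        + 6 * (Q * v₁ * v₁) + 12 * (Q * v₁ * T) + 12 * (v₂ * v₂ * v₁) + 6 * (v₂ * v₃ * v₁) + 12 * (v₂ * v₁ * T)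
        + 6 * ((AG Q v₁ v₂ v₃ T) * Q) + 12 * ((AG Q v₁ v₂ v₃ T) * v₂) + 6 * ((AG Q v₁ v₂ v₃ T) * T))
        + u₃ * u₁ * t * (12 * (Q * v₃ * v₂) + 6 * (Q * v₂ * v₂) + 12 * (Q * v₂ * T) + 12 * (v₃ * v₃ * v₂)
        + 6 * (v₃ * v₁ * v₂) + 12 * (v₃ * v₂ * T) + 6 * ((AG Q v₁ v₂ v₃ T) * Q) + 12 * ((AG Q v₁ v₂ v₃ T) * v₃)
        + 6 * ((AG Q v₁ v₂ v₃ T) * T)) + u₃ * u₂ * t * (12 * (Q * v₃ * v₁) + 6 * (Q * v₁ * v₁) + 12 * (Q * v₁ * T)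
        + 12 * (v₃ * v₃ * v₁) + 6 * (v₃ * v₂ * v₁) + 12 * (v₃ * v₁ * T) + 6 * ((AG Q v₁ v₂ v₃ T) * Q)
        + 12 * ((AG Q v₁ v₂ v₃ T) * v₃) + 6 * ((AG Q v₁ v₂ v₃ T) * T)) + (AG q u₁ u₂ u₃ t) * q * (12 * (Q * Q * T)
        + 12 * (Q * v₁ * T) + 12 * (Q * v₂ * T) + 12 * (Q * v₃ * T) + 12 * (Q * T * T))
        + (AG q u₁ u₂ u₃ t) * u₁ * (12 * (Q * Q * v₂) + 12 * (Q * Q * v₃) + 24 * (Q * Q * T) + 12 * (Q * v₁ * T)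
        + 12 * (Q * v₂ * v₂) + 12 * (Q * v₃ * v₃) + 16 * (Q * v₂ * T) + 16 * (Q * v₃ * T) + 6 * (Q * T * T)
        + 8 * (v₁ * v₂ * v₂) + 8 * (v₁ * v₃ * v₃) + 6 * (v₁ * v₂ * T) + 6 * (v₁ * v₃ * T))
        + (AG q u₁ u₂ u₃ t) * u₂ * (12 * (Q * Q * v₁) + 12 * (Q * Q * v₃) + 24 * (Q * Q * T) + 12 * (Q * v₂ * T)
        + 12 * (Q * v₁ * v₁) + 12 * (Q * v₃ * v₃) + 16 * (Q * v₁ * T) + 16 * (Q * v₃ * T) + 6 * (Q * T * T)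
        + 8 * (v₂ * v₁ * v₁) + 8 * (v₂ * v₃ * v₃) + 6 * (v₂ * v₁ * T) + 6 * (v₂ * v₃ * T))
        + (AG q u₁ u₂ u₃ t) * u₃ * (12 * (Q * Q * v₁) + 12 * (Q * Q * v₂) + 24 * (Q * Q * T) + 12 * (Q * v₃ * T)
        + 12 * (Q * v₁ * v₁) + 12 * (Q * v₂ * v₂) + 16 * (Q * v₁ * T) + 16 * (Q * v₂ * T) + 6 * (Q * T * T)
        + 8 * (v₃ * v₁ * v₁) + 8 * (v₃ * v₂ * v₂) + 6 * (v₃ * v₁ * T) + 6 * (v₃ * v₂ * T))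
        + (AG q u₁ u₂ u₃ t) * t * (12 * (Q * Q * v₁) + 12 * (Q * Q * v₂) + 12 * (Q * Q * v₃) + 24 * (Q * Q * T)
        + 12 * (Q * v₁ * v₁) + 12 * (Q * v₂ * v₂) + 12 * (Q * v₃ * v₃) + 12 * (Q * v₁ * v₂) + 12 * (Q * v₁ * v₃)
        + 12 * (Q * v₂ * v₁) + 12 * (Q * v₂ * v₃) + 12 * (Q * v₃ * v₁) + 12 * (Q * v₃ * v₂) + 24 * (Q * v₁ * T)
        + 24 * (Q * v₂ * T) + 24 * (Q * v₃ * T) + 12 * (Q * T * T)) + (Ha q u₁ u₂ u₃ t) * (12 * (Q * Q * Q)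
        + 12 * (Q * Q * v₁) + 12 * (Q * Q * v₂) + 12 * (Q * Q * v₃)) + (t - q) * q * q * (2 * (v₁ * v₂ * v₃)
        + 2 * (v₁ * v₃ * v₂) + 2 * (v₂ * v₁ * v₃) + 2 * (v₂ * v₃ * v₁) + 2 * (v₃ * v₁ * v₂) + 2 * (v₃ * v₂ * v₁))
        + (t - q) * q * u₁ * (6 * (Q * v₂ * v₃) + 6 * (Q * v₃ * v₂) + 6 * (v₁ * v₂ * v₃) + 6 * (v₁ * v₃ * v₂))
        + (t - q) * q * u₂ * (6 * (Q * v₁ * v₃) + 6 * (Q * v₃ * v₁) + 6 * (v₂ * v₁ * v₃) + 6 * (v₂ * v₃ * v₁))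
        + (t - q) * q * u₃ * (6 * (Q * v₁ * v₂) + 6 * (Q * v₂ * v₁) + 6 * (v₃ * v₁ * v₂) + 6 * (v₃ * v₂ * v₁))
        + (t - q) * u₁ * u₂ * (6 * (Q * Q * v₃) + 12 * (Q * v₁ * v₃)) + (t - q) * u₁ * u₃ * (6 * (Q * Q * v₂)
        + 12 * (Q * v₁ * v₂)) + (t - q) * u₂ * u₁ * (6 * (Q * Q * v₃) + 12 * (Q * v₂ * v₃))
        + (t - q) * u₂ * u₃ * (6 * (Q * Q * v₁) + 12 * (Q * v₂ * v₁)) + (t - q) * u₃ * u₁ * (6 * (Q * Q * v₂)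
        + 12 * (Q * v₃ * v₂)) + (t - q) * u₃ * u₂ * (6 * (Q * Q * v₁) + 12 * (Q * v₃ * v₁)) := by
    subst hzq hz₁ hz₂ hz₃ hzt
    simp only [Ha, Hb, AG]
    ring
  have hR : 0 ≤ 12 * Ha zq z₁ z₂ z₃ zt := by
    rw [key]
    generalize AG q u₁ u₂ u₃ t = A at hagx ⊢
    generalize AG Q v₁ v₂ v₃ T = A' at hagy ⊢
    generalize Ha q u₁ u₂ u₃ t = H at hHax ⊢
    generalize Hb Q v₁ v₂ v₃ T = B' at hHby ⊢
    generalize t - q = D at htqx ⊢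
    positivity
  linarith

/-- **K3-SEMIGROUP THEOREM.**  `S₀ = {cells ≥ 0, AG ≥ 0, max(Ha,Hb) ≥ 0}` is closed under parallel composition: for `x, y ∈ S₀` the
composite `z` has `AG(z) ≥ 0` (`AG_join_nonneg`) and `max(Ha,Hb)(z) ≥ 0`.  Cases: a factor is "dense-type" (`Ha ≥ 0 ∧ t ≥ q`) or else
(within `S₀`) it has `Hb ≥ 0`; dense ⊔ dense (`Ha_join_dense_dense`), dense ⊔ sparse (`Ha_join_dense_sparse`, either order by the
symmetry of `⊔`), sparse ⊔ sparse (`Hb_join_nonneg`). [folklore] -/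
theorem maxH_join_nonneg {q u₁ u₂ u₃ t Q v₁ v₂ v₃ T zq z₁ z₂ z₃ zt : ℝ}
    (hq : 0 ≤ q) (hu₁ : 0 ≤ u₁) (hu₂ : 0 ≤ u₂) (hu₃ : 0 ≤ u₃) (ht : 0 ≤ t)
    (hQ : 0 ≤ Q) (hv₁ : 0 ≤ v₁) (hv₂ : 0 ≤ v₂) (hv₃ : 0 ≤ v₃) (hT : 0 ≤ T)
    (hagx : 0 ≤ AG q u₁ u₂ u₃ t) (hagy : 0 ≤ AG Q v₁ v₂ v₃ T)
    (hHx : 0 ≤ max (Ha q u₁ u₂ u₃ t) (Hb q u₁ u₂ u₃ t)) (hHy : 0 ≤ max (Ha Q v₁ v₂ v₃ T) (Hb Q v₁ v₂ v₃ T))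
    (hzq : zq = q * Q) (hz₁ : z₁ = q * v₁ + u₁ * Q + u₁ * v₁) (hz₂ : z₂ = q * v₂ + u₂ * Q + u₂ * v₂)
    (hz₃ : z₃ = q * v₃ + u₃ * Q + u₃ * v₃)
    (hzt : zt = t * (Q + v₁ + v₂ + v₃ + T) + T * (q + u₁ + u₂ + u₃) + (u₁ * (v₂ + v₃) + u₂ * (v₁ + v₃) + u₃ * (v₁ + v₂))) :
    0 ≤ max (Ha zq z₁ z₂ z₃ zt) (Hb zq z₁ z₂ z₃ zt) := by
  -- within S₀, a law that is not dense-type has Hb ≥ 0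
  have sparse_of_not_dense : ∀ {a b c d e : ℝ}, 0 ≤ AG a b c d e → 0 ≤ max (Ha a b c d e) (Hb a b c d e) →
      ¬ (0 ≤ Ha a b c d e ∧ 0 ≤ e - a) → 0 ≤ Hb a b c d e := by
    intro a b c d e hag hmax hnd
    have hsub : Ha a b c d e - Hb a b c d e = (e - a) * AG a b c d e := Ha_sub_Hb a b c d e
    by_cases hha : 0 ≤ Ha a b c d e
    · have hea : e - a < 0 := by
        by_contra hc
        exact hnd ⟨hha, not_lt.mp hc⟩
      have : (e - a) * AG a b c d e ≤ 0 := mul_nonpos_of_nonpos_of_nonneg hea.le hag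
      linarith
    · rcases le_max_iff.mp hmax with h | h
      · exact absurd h hha
      · exact h
  by_cases hdx : 0 ≤ Ha q u₁ u₂ u₃ t ∧ 0 ≤ t - q
  · by_cases hdy : 0 ≤ Ha Q v₁ v₂ v₃ T ∧ 0 ≤ T - Q
    · exact le_max_of_le_left (Ha_join_dense_dense hq hu₁ hu₂ hu₃ ht hQ hv₁ hv₂ hv₃ hT hagx hagy hdx.1 hdy.1 hdx.2 hdy.2
        hzq hz₁ hz₂ hz₃ hzt)
    · exact le_max_of_le_left (Ha_join_dense_sparse hq hu₁ hu₂ hu₃ ht hQ hv₁ hv₂ hv₃ hT hagx hagy hdx.1 hdx.2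
        (sparse_of_not_dense hagy hHy hdy) hzq hz₁ hz₂ hz₃ hzt)
  · have hbx : 0 ≤ Hb q u₁ u₂ u₃ t := sparse_of_not_dense hagx hHx hdx
    by_cases hdy : 0 ≤ Ha Q v₁ v₂ v₃ T ∧ 0 ≤ T - Q
    · -- y dense, x sparse: use the symmetry of the composition
      refine le_max_of_le_left (Ha_join_dense_sparse hQ hv₁ hv₂ hv₃ hT hq hu₁ hu₂ hu₃ ht hagy hagx hdy.1 hdy.2 hbx
        (zq := zq) (z₁ := z₁) (z₂ := z₂) (z₃ := z₃) (zt := zt) ?_ ?_ ?_ ?_ ?_)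
      · rw [hzq]; ring
      · rw [hz₁]; ring
      · rw [hz₂]; ring
      · rw [hz₃]; ring
      · rw [hzt]; ring
    · exact le_max_of_le_right (Hb_join_nonneg hq hu₁ hu₂ hu₃ hQ hv₁ hv₂ hv₃ hT hbx (sparse_of_not_dense hagy hHy hdy)
        hzq hz₁ hz₂ hz₃ hzt)

/-- **Dual (meet) composition.**  `S₀` is also closed under the dual composition `z = x ⊓ y` (independent systems combined by the
MEET of the partition lattice: `z_t = tT`, `z_i = t vᵢ + uᵢ T + uᵢ vᵢ`, `z_q = q·σ(y) + Q·σ(x) − qQ + Σ_{i≠j} uᵢ vⱼ`; stars are meets of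
pendant laws) — the `q ↔ t` dual of `maxH_join_nonneg` (`Ha ↔ Hb`, `AG` self-dual). [folklore] -/
theorem maxH_meet_nonneg {q u₁ u₂ u₃ t Q v₁ v₂ v₃ T zq z₁ z₂ z₃ zt : ℝ}
    (hq : 0 ≤ q) (hu₁ : 0 ≤ u₁) (hu₂ : 0 ≤ u₂) (hu₃ : 0 ≤ u₃) (ht : 0 ≤ t)
    (hQ : 0 ≤ Q) (hv₁ : 0 ≤ v₁) (hv₂ : 0 ≤ v₂) (hv₃ : 0 ≤ v₃) (hT : 0 ≤ T)
    (hagx : 0 ≤ AG q u₁ u₂ u₃ t) (hagy : 0 ≤ AG Q v₁ v₂ v₃ T)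
    (hHx : 0 ≤ max (Ha q u₁ u₂ u₃ t) (Hb q u₁ u₂ u₃ t)) (hHy : 0 ≤ max (Ha Q v₁ v₂ v₃ T) (Hb Q v₁ v₂ v₃ T))
    (hzt : zt = t * T) (hz₁ : z₁ = t * v₁ + u₁ * T + u₁ * v₁) (hz₂ : z₂ = t * v₂ + u₂ * T + u₂ * v₂)
    (hz₃ : z₃ = t * v₃ + u₃ * T + u₃ * v₃)
    (hzq : zq = q * (T + v₁ + v₂ + v₃ + Q) + Q * (t + u₁ + u₂ + u₃) + (u₁ * (v₂ + v₃) + u₂ * (v₁ + v₃) + u₃ * (v₁ + v₂))) :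
    0 ≤ max (Ha zq z₁ z₂ z₃ zt) (Hb zq z₁ z₂ z₃ zt) ∧ 0 ≤ AG zq z₁ z₂ z₃ zt := by
  -- pass to the dual laws (t,u,q), (T,v,Q): their JOIN has cells (zt, z₁, z₂, z₃, zq)
  have hagx' : 0 ≤ AG t u₁ u₂ u₃ q := by rw [AG_dual q u₁ u₂ u₃ t]; exact hagx
  have hagy' : 0 ≤ AG T v₁ v₂ v₃ Q := by rw [AG_dual Q v₁ v₂ v₃ T]; exact hagy
  have hHx' : 0 ≤ max (Ha t u₁ u₂ u₃ q) (Hb t u₁ u₂ u₃ q) := by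
    rw [Ha_dual q u₁ u₂ u₃ t, Hb_dual q u₁ u₂ u₃ t, max_comm]; exact hHx
  have hHy' : 0 ≤ max (Ha T v₁ v₂ v₃ Q) (Hb T v₁ v₂ v₃ Q) := by
    rw [Ha_dual Q v₁ v₂ v₃ T, Hb_dual Q v₁ v₂ v₃ T, max_comm]; exact hHy
  have hj := maxH_join_nonneg ht hu₁ hu₂ hu₃ hq hT hv₁ hv₂ hv₃ hQ hagx' hagy' hHx' hHy' hzt hz₁ hz₂ hz₃ hzq
  have ha := AG_join_nonneg ht hu₁ hu₂ hu₃ hq hT hv₁ hv₂ hv₃ hagx' hagy' hzt hz₁ hz₂ hz₃ hzq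
  refine ⟨?_, ?_⟩
  · rw [Ha_dual zq z₁ z₂ z₃ zt, Hb_dual zq z₁ z₂ z₃ zt, max_comm] at hj; exact hj
  · rw [AG_dual zq z₁ z₂ z₃ zt] at ha; exact ha

end CubicThreePointJoin

end Summit.CriticalPhenomena.PercolationContinuityZ3.Theorems
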